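import Summits.BirchSwinnertonDyer.Rank1Residual.X12.O11.RamifiedStrictDescentAtThree
import Summits.BirchSwinnertonDyer.BirchSwinnertonDyer.Theorems.RamifiedSevenEllipticUnitsStrictControlAnticyclotomicCM
import HarnessLib

/-!
# O11 at `p = 3`, companion I — the two LOCAL inputs of the `3`-typing in the kernel: frames exist,
# (A𝔭)₃ `W(K_𝔭)[3] = 0` from the two `ℚ₃`-binders, EXACT CONTROL at a `3`-frame for anticyclotomic `κ`
# from (A𝔭)₃ + the degree-one away input, and the twist-descent count (D♮)₃
# (cell `bsd-print-cfram`, D-0131 (2), typer seat `ty2`; sequel of p539796 `RamifiedStrictDescentAtThree.lean`)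

HONEST FRAMING (cell `bsd-print-cfram`, HOME `run/shared/lean/pub/bsd-print-cfram/`; frames of record:
O11 `X12/O11/RamifiedStrictDescent.lean` and its `p = 3` re-typing `RamifiedStrictDescentAtThree.lean`):
THEOREMS ONLY (no definition, no named fact, no axiom, no `sorry`); nothing about BSD is asserted or
booked; the `p = 3` slice of K12r stays OPEN. This file puts into the kernel, at `p = 3`, exactly the
`p`-generic part of the bsd-cm K7r chain (k7r-c3/c4: `…StrictControlExactControl`,
`…StrictControlAnticyclotomicCM`, `…StrictTorsionOfGZKAnyPrime`, `…StrictControlAnyPrime`) whose only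
`p ≥ 5`-dependence was Mazur's Step 1 — here replaced by the two DISPLAYED local binders of the
`3`-typing ((A𝔭)₃ via `W(ℚ₃)[3] = 0 = W'(ℚ₃)[3]`; (Av)₃ at the degree-one places):

* §0 `not_isFrame_three` / `o11_inputs_three_vacuous` (O11's own frame is EMPTY at `3`, its inputs
  vacuous there — the reason for the re-typing), `IsFrameThree.cmFieldDiscrOfJ_eq`, `IsFrameThree.twist_eq`
  (`W' = C • W^{(−3)}`), `exists_isFrameThree_of_cmRamified` (a `3`-frame exists at every CM `W` with
  `3 ∣ d_K`);
* §1 `noPTorsion_adicCompletion_of_twist` (every odd `p`: `W(ℚ_p)[p] = 0 ∧ W'(ℚ_p)[p] = 0 ⟹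
  W_K(K_𝔭)[p] = 0` by quadratic descent along `K_𝔭 = ℚ_p(√−p)`, Silverman *AEC* Ex. 10.16) and
  `noThreeTorsion_adicCompletion_of_isFrameThree` ((A𝔭)₃ = BKNO (3.16) at the bottom, at `3`);
* §2 `awayConditions_descend_three` (anticyclotomic tower of a quadratic field: inert / ramified places
  split completely and descend with NO hypothesis; degree-one places use the displayed input),
  `controlMap_bijective_of_isFrameThree`, `strictControl_frameThree_natCard_eq`,
  `strictControl_frameThree_finite_iff` (EXACT CONTROL `Sel_𝔭(K, E[3^∞]) ≅ Sel_𝔭(K^ac_∞, E[3^∞])^Γ`);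
* §3 `natCard_selmerAcBase_frameThree_eq_mul` ((D♮)₃: `#Sel_𝔭(K, E[3^∞]) = #Sel_str(E/ℚ)[3^∞] ·
  #Sel_str(E'/ℚ)[3^∞]`, unconditional, `3` odd).
Companion II (`RamifiedStrictDescentAtThreeDischarge.lean`): (R-ctrl)₃ outright, (R-tors)₃ ⟸ GZK.

References: [GreenbergLNM1716] §3 Lemmas 3.1–3.3, p. 87, Thm. 1.2; [Washington1997] Prop. 13.2, §13.1;
[Brink2007] §1 (inert primes split completely in the anticyclotomic extension); [SilvermanAEC2009]
Ex. 10.16; [Castella2018] Def. 2.2 (arXiv:1704.06608 p. 5); [DokchitserDokchitserAnnals2010] Lemma 4.14;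
[SilvermanATAEC1994] App. A §3; [BurungaleKobayashiNakamuraOta2026] (3.16) (arXiv:2608.06879 §3.4,
stated for `p ≥ 3`, at `K_p ≅ ℚ₃(√−3)` under Assumption 3.1 (1); shape only; claim; preprint).
-/

noncomputable section

open scoped Classical

open WeierstrassCurve NumberField IsDedekindDomain Field PowerSeries
  Literature.NumberTheory.EllipticCurves
  Literature.NumberTheory.EllipticCurves.GreenbergSelmer
  Literature.NumberTheory.EllipticCurves.Rank1Residual
  Literature.NumberTheory.GaloisRepresentations
  Summit.BirchSwinnertonDyer.Rank1Residual
  Summit.BirchSwinnertonDyer.Rank1Residual.Additive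
  Summit.BirchSwinnertonDyer.Rank1Residual.X11b
  Summit.BirchSwinnertonDyer.Rank1Residual.X11b.AcSelmer
  Summit.BirchSwinnertonDyer.BirchSwinnertonDyer.Theorems

namespace Summit.BirchSwinnertonDyer.Rank1Residual.X12.O11

/-! ## §0 O11's frame is empty at `3`; `3`-frames exist; small API -/

section FrameAPI

variable {W : WeierstrassCurve ℚ} [W.IsElliptic]
  {K : Type} [Field K] [NumberField K] {𝔭 : HeightOneSpectrum (𝓞 K)}
  {W' : WeierstrassCurve ℚ} {C : VariableChange ℚ}

/-- **O11's frame is EMPTY at `p = 3`**: `IsFrame W 3 K 𝔭 W' C` carries `5 ≤ 3`. [folklore] -/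
theorem not_isFrame_three : ¬ IsFrame W 3 K 𝔭 W' C :=
  fun hF ↦ absurd hF.2.2.1 (by decide)

/-- **O11's three typed inputs hold VACUOUSLY at `p = 3`** (their frames are empty): they carry no
content at `3` — which is why (R-tors)₃ / (R-ctrl)₃ / (R-EU)₃ were re-typed over `IsFrameThree`. Do NOT
cite this as mathematics. [folklore] -/
theorem o11_inputs_three_vacuous [W.IsGloballyMinimal] :
    RamifiedCMStrictTorsionAt W 3 ∧ RamifiedCMStrictControlAt W 3 ∧
      RamifiedCMEllipticUnitIndexAt W 3 :=
  ⟨fun _ _ _ _ _ _ _ _ hF ↦ absurd hF not_isFrame_three,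
    fun _ _ _ _ _ _ _ _ hF ↦ absurd hF not_isFrame_three,
    fun _ _ _ _ _ _ _ _ hF ↦ absurd hF not_isFrame_three⟩

/-- At a `3`-frame `d_K(j(W)) = −3`. [cite: SilvermanATAEC1994, App. A §3 (table of CM j-invariants)] -/
theorem IsFrameThree.cmFieldDiscrOfJ_eq (hF : IsFrameThree W K 𝔭 W' C) : cmFieldDiscrOfJ W.j = -3 :=
  (LeafInterface.leaf_arith_three W hF.1 hF.2.1).1

/-- At a `3`-frame the twin is a (globally minimal) model of `W^{(−3)}`: `C • W^{(−3)} = W'`.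
[cite: SilvermanATAEC1994, App. A §3 (table of CM j-invariants)] -/
theorem IsFrameThree.twist_eq (hF : IsFrameThree W K 𝔭 W' C) :
    C • W.quadraticTwist (-3 : ℚ) = W' := by
  have h := hF.2.2.2.2.2
  rw [hF.cmFieldDiscrOfJ_eq] at h
  simpa using h

end FrameAPI

/-- **A `3`-frame exists at every CM curve `W/ℚ` with `3 ∣ d_K`**: the frame field `K = ℚ(√−3)` with
its prime `𝔭 ∋ 3` (`LeafInterface.exists_frameField_three`) and a globally minimal model of the twist
`W^{(−3)}` (`hasGlobalMinimalModel_rat_holds`).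
[cite: SilvermanATAEC1994, App. A §3 (table of CM j-invariants)] [cite: SilvermanAEC2009, Cor. VIII.8.3 (global minimal models over ℚ)] -/
theorem exists_isFrameThree_of_cmRamified (W : WeierstrassCurve ℚ) [W.IsElliptic] (hCM : W.HasCM)
    (hram : CMRamified W 3) :
    ∃ (K : Type) (_ : Field K) (_ : NumberField K) (𝔭 : HeightOneSpectrum (𝓞 K))
      (W' : WeierstrassCurve ℚ) (_ : W'.IsElliptic) (_ : W'.IsGloballyMinimal) (C : VariableChange ℚ),
      IsFrameThree W K 𝔭 W' C := by
  obtain ⟨K, _, _, 𝔭, hK, hdK, h𝔭⟩ := LeafInterface.exists_frameField_three W hCM hram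
  have hd0 : ((cmFieldDiscrOfJ W.j : ℤ) : ℚ) ≠ 0 := by
    rw [(LeafInterface.leaf_arith_three W hCM hram).1]; norm_num
  haveI := W.isElliptic_quadraticTwist hd0
  obtain ⟨C, hC⟩ := hasGlobalMinimalModel_rat_holds (W.quadraticTwist ((cmFieldDiscrOfJ W.j : ℤ) : ℚ))
  haveI := hC
  exact ⟨K, inferInstance, inferInstance, 𝔭, C • W.quadraticTwist ((cmFieldDiscrOfJ W.j : ℤ) : ℚ),
    inferInstance, hC, C, hCM, hram, hK, hdK, h𝔭, rfl⟩

/-! ## §1 (A𝔭)₃: `W(K_𝔭)[3] = 0` from the two `ℚ₃`-binders (BKNO (3.16) at the bottom, at `3`) -/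

/-- **Quadratic descent of "no `p`-torsion" along `K_𝔭 = ℚ_p(√−p)`, every odd prime `p`.** For `W/ℚ`
elliptic, `K` imaginary quadratic with `discr K = −p`, `𝔭 ∋ p`, and a model `W' = C • W^{(−p)}` of the
twist: if `W(ℚ_p)[p] = 0` and `W'(ℚ_p)[p] = 0` then `W_K(K_𝔭)[p] = 0`. (`[K_𝔭 : ℚ_p] = 2` as
`−p ∉ ℚ_p²`; `#E(L)[p^∞] = #W(F)[p^∞] · #W'(F)[p^∞]` for the quadratic extension `L = K_𝔭 / F = ℚ_v(p)`,
Silverman *AEC* Ex. 10.16, tree `card_primaryComponent_point_baseChange_quadratic_of_odd'`.) This is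
k7r-c4's `noPTorsion_adicCompletion_of_isFrame` with Mazur's Step 1 (which needs `p ≥ 5`) replaced by
the two displayed hypotheses. [cite: SilvermanAEC2009, Exercise 10.16]
[cite: BurungaleKobayashiNakamuraOta2026, (3.16) (arXiv:2608.06879; statement at the bottom layer, shape only)] -/
theorem noPTorsion_adicCompletion_of_twist (W : WeierstrassCurve ℚ) [W.IsElliptic] (p : ℕ)
    [Fact p.Prime] (hp2 : p ≠ 2) {K : Type} [Field K] [NumberField K] {𝔭 : HeightOneSpectrum (𝓞 K)}
    {W' : WeierstrassCurve ℚ} [W'.IsElliptic] {C : VariableChange ℚ} (hK : IsImaginaryQuadratic K)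
    (hdisc : NumberField.discr K = -(p : ℤ)) (h𝔭 : ((p : ℕ) : 𝓞 K) ∈ 𝔭.asIdeal)
    (hW' : C • W.quadraticTwist (-(p : ℚ)) = W')
    (hpW : ∀ Q : (W.baseChange ℚ_[p]).toAffine.Point, p • Q = 0 → Q = 0)
    (hpW' : ∀ Q : (W'.baseChange ℚ_[p]).toAffine.Point, p • Q = 0 → Q = 0) :
    ∀ R : ((W.baseChange K).baseChange (𝔭.adicCompletion K)).toAffine.Point, p • R = 0 → R = 0 := by
  have hp : p.Prime := Fact.out
  -- the local fields `F = ℚ_v(p)` and `L = K_𝔭`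
  haveI : 𝔭.asIdeal.LiesOver (ratPlace p).asIdeal := ⟨by rw [← under_eq_ratPlace_of_mem h𝔭]; rfl⟩
  set F : Type := (ratPlace p).adicCompletion ℚ with hFdef
  set L : Type := 𝔭.adicCompletion K with hLdef
  haveI : CharZero F := charZero_of_injective_algebraMap (algebraMap ℚ F).injective
  haveI : CharZero L := charZero_of_injective_algebraMap (algebraMap K L).injective
  letI : Algebra F L := (adicCompletionMap (K := ℚ) K (ratPlace p) 𝔭).toAlgebra
  obtain ⟨hfin, hle⟩ := finrank_adicCompletion_le_of_liesOver (K := ℚ) K (ratPlace p) 𝔭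
  haveI : FiniteDimensional F L := hfin
  rw [hK.1] at hle
  -- `F ≃ ℚ_p` and the transports of "no `p`-torsion" to `F`
  let e : F →+* ℚ_[p] :=
    (Padic.adicCompletionEquiv (𝓞 ℚ) ⟨p, hp⟩).symm.toAlgEquiv.toRingEquiv.toRingHom
  have hpF : ∀ R : (W.baseChange F).toAffine.Point, p • R = 0 → R = 0 :=
    RamifiedSevenEllipticUnits.noPTorsion_baseChange_of_algHom W p e.toRatAlgHom hpW
  have hpF' : ∀ R : (W'.baseChange F).toAffine.Point, p • R = 0 → R = 0 :=
    RamifiedSevenEllipticUnits.noPTorsion_baseChange_of_algHom W' p e.toRatAlgHom hpW'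
  -- `√−p ∈ L`, not in `F`
  obtain ⟨θ₁, -, hθ₁sq⟩ := exists_sq_eq_discr_not_mem_range K hK.1
  rw [hdisc] at hθ₁sq
  simp only [Int.cast_neg, Int.cast_natCast, map_neg, map_natCast] at hθ₁sq
  set θ : L := algebraMap K L θ₁ with hθdef
  have hθsq : θ ^ 2 = algebraMap F L (-(p : F)) := by
    rw [map_neg, map_natCast, hθdef, ← map_pow, hθ₁sq, map_neg, map_natCast]
  have hθ : θ ∉ Set.range (algebraMap F L) := by
    rintro ⟨x, hx⟩
    have hx2 : x ^ 2 = -(p : F) :=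
      (algebraMap F L).injective (by rw [map_pow, hx, hθsq, map_neg, map_natCast])
    apply RamifiedSevenEllipticUnits.not_sq_eq_neg_prime_padic p (e x)
    rw [← map_pow, hx2, map_neg, map_natCast]
  -- `[L : F] = 2`
  have h2 : Module.finrank F L = 2 := by
    have hle' : Module.finrank F L ≤ 2 := hle
    have hpos : 0 < Module.finrank F L := Module.finrank_pos
    have hne1 : Module.finrank F L ≠ 1 := by
      intro h1
      have hbot : (⊥ : Subalgebra F L) = ⊤ := Subalgebra.bot_eq_top_iff_finrank_eq_one.mpr h1
      apply hθ
      have hmem : θ ∈ (⊥ : Subalgebra F L) := by rw [hbot]; exact Algebra.mem_top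
      rwa [Algebra.mem_bot] at hmem
    omega
  -- the quadratic descent of `p`-primary torsion: `#E(L)[p^∞] = #W(F)[p^∞] · #W'(F)[p^∞]`
  have hWd : ∃ D : VariableChange F,
      D • (W.baseChange F).quadraticTwist (-(p : F)) = W'.baseChange F := by
    refine ⟨C.map (algebraMap ℚ F), ?_⟩
    have hpF0 : (-(p : F)) = algebraMap ℚ F (-(p : ℚ)) := by rw [map_neg, map_natCast]
    rw [hpF0, baseChange, baseChange, ← map_quadraticTwist, map_variableChange, hW']
  have hKL : (W.baseChange K).baseChange L = W.baseChange L :=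
    W.map_baseChange (algebraMap K L).toRatAlgHom
  have hFL : (W.baseChange F).baseChange L = W.baseChange L :=
    W.map_baseChange (algebraMap F L).toRatAlgHom
  have hmodel : ∃ D : VariableChange L,
      D • (W.baseChange F).baseChange L = (W.baseChange K).baseChange L :=
    ⟨1, by rw [one_smul, hFL, hKL]⟩
  have key := card_primaryComponent_point_baseChange_quadratic_of_odd' (W.baseChange F) h2 hθ hθsq
    hWd hmodel p hp2
  rw [(RamifiedSevenEllipticUnits.natCard_primaryComponent_eq_one_iff p).mpr hpF,
    (RamifiedSevenEllipticUnits.natCard_primaryComponent_eq_one_iff p).mpr hpF', mul_one] at key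
  exact (RamifiedSevenEllipticUnits.natCard_primaryComponent_eq_one_iff p).mp key

/-- **(A𝔭)₃ at a `3`-frame from the two `ℚ₃`-binders**: `W(ℚ₃)[3] = 0` and `W'(ℚ₃)[3] = 0` give
`W_K(K_𝔭)[3] = 0` (`K_𝔭 = ℚ₃(√−3)`). At `p ≥ 5` both binders are theorems (Mazur); at `3` they are the
displayed restriction of the typing. [cite: SilvermanAEC2009, Exercise 10.16]
[cite: BurungaleKobayashiNakamuraOta2026, (3.16) (arXiv:2608.06879 §3.4; `p ≥ 3`, at `3` under Assumption 3.1 (1); shape only)] -/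
theorem noThreeTorsion_adicCompletion_of_isFrameThree (W : WeierstrassCurve ℚ) [W.IsElliptic]
    {K : Type} [Field K] [NumberField K] {𝔭 : HeightOneSpectrum (𝓞 K)}
    {W' : WeierstrassCurve ℚ} [W'.IsElliptic] {C : VariableChange ℚ} (hF : IsFrameThree W K 𝔭 W' C)
    (htors : ∀ Q : (W.baseChange ℚ_[3]).toAffine.Point, (3 : ℕ) • Q = 0 → Q = 0)
    (htors' : ∀ Q : (W'.baseChange ℚ_[3]).toAffine.Point, (3 : ℕ) • Q = 0 → Q = 0) :
    ∀ R : ((W.baseChange K).baseChange (𝔭.adicCompletion K)).toAffine.Point,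
      (3 : ℕ) • R = 0 → R = 0 :=
  noPTorsion_adicCompletion_of_twist W 3 (by decide) (C := C) hF.2.2.1 (by rw [hF.discr_eq]; norm_num)
    hF.2.2.2.2.1 (by simpa using hF.twist_eq) htors htors'

/-! ## §2 Exact control at a `3`-frame, anticyclotomic `κ`: the away input at DEGREE-ONE places only -/

section Control

variable (W : WeierstrassCurve ℚ) [W.IsElliptic] {K : Type} [Field K] [NumberField K]

/-- **The away conditions descend at every finite `v ∤ 3` in the anticyclotomic `ℤ₃`-tower of a
quadratic field, GIVEN the degree-one input.** `K` a number field with `[K : ℚ] = 2`, `κ` an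
ANTICYCLOTOMIC `ℤ₃`-extension, `𝔭` any finite place, `Σ = ∅`; hypothesis (Av)₃: at every `v ∤ 3` of
degree one (`e = f = 1` over `ℚ`), `W_K` has good reduction at `v` or `W(K_v)[3] = 0`. If
`c ∈ H¹(K, W[3^∞])` restricts into `Sel_𝔭(K_∞, W[3^∞])`, then `c` is locally trivial at every finite
`v ∤ 3`: at a degree-one `v`, Greenberg's Lemma 3.3 (good) or `ker r_v = 0` (no `3`-torsion); a place
of residue degree `2` or ramification index `2` splits completely in the anticyclotomic tower and the
condition descends tautologically (trichotomy of the places of a quadratic field). k7r-c3's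
`awayConditions_descend_of_isAnticyclotomic` with Mazur's Step 1 (`p ≥ 5`) replaced by the hypothesis.
[cite: GreenbergLNM1716, §3 Lemma 3.3 and p. 87 (primes splitting completely)] [cite: Washington1997, Prop. 13.2 and §13.1] -/
theorem awayConditions_descend_three (hK : Module.finrank ℚ K = 2)
    {κ : ZpExtension K 3} (hκ : κ.IsAnticyclotomic) (𝔭 : HeightOneSpectrum (𝓞 K))
    (hv : ∀ v : HeightOneSpectrum (𝓞 K), ((3 : ℕ) : 𝓞 K) ∉ v.asIdeal →
      v.asIdeal.ramificationIdx (𝓞 ℚ) = 1 → v.asIdeal.inertiaDeg (𝓞 ℚ) = 1 →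
      (W.baseChange K).HasGoodReductionAt v ∨
        ∀ R : ((W.baseChange K).baseChange (v.adicCompletion K)).toAffine.Point,
          (3 : ℕ) • R = 0 → R = 0)
    (c : (W.baseChange K).subgroupH1 3 (⊤ : Subgroup (absoluteGaloisGroup K)))
    (hc : (W.baseChange K).resOfLe 3 (le_top : κ.kerSubgroup ≤ ⊤) c ∈
      selmerAc (W.baseChange K) 3 κ 𝔭 ∅)
    (v : HeightOneSpectrum (𝓞 K)) (hpv : ((3 : ℕ) : 𝓞 K) ∉ v.asIdeal) :
    c ∈ awayKer ⊤ ((W.baseChange K).geomPrimaryTorsion 3) v := by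
  haveI : (W.baseChange K).IsElliptic := by rw [baseChange]; infer_instance
  have hvS : v ∉ (∅ : Set (HeightOneSpectrum (𝓞 K))) := Set.notMem_empty v
  -- the away condition at the place of `K_∞` above `v`
  have h1 := ((mem_selmerOver_iff _).mp hc).1 v hpv hvS 1
  rw [Literature.NumberTheory.EllipticCurves.conjH1_one_holds, AddMonoidHom.id_apply] at h1
  set v₀ : HeightOneSpectrum (𝓞 ℚ) := v.under (𝓞 ℚ) with hv₀def
  rcases placesOver_trichotomy_of_finrank_eq_two K hK v₀ with
      ⟨w₁, w₂, -, -, hef⟩ | ⟨w, hset, -, hf⟩ | ⟨w, hset, he, -⟩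
  · -- degree one: the displayed input (Av)₃
    obtain ⟨he, hf⟩ := hef v rfl
    rcases hv v hpv he hf with hgood | htors
    · exact (resOfLe_mem_awayKer_kerSubgroup_iff_of_hasGoodReductionAt (W.baseChange K) 3 κ hpv
        hgood c).mp h1
    · exact mem_awayKer_of_localKer_eq_bot hpv hvS
        (AcSelmer.localKer_eq_bot_of_noPTorsion (W.baseChange K) 3 κ v htors) hc
  · -- residue degree two: `v` splits completely in the anticyclotomic tower
    have hvw : v = w := by
      have hmem : v ∈ {w' : HeightOneSpectrum (𝓞 K) | w'.under (𝓞 ℚ) = v₀} := rfl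
      rw [hset] at hmem
      exact hmem
    have hf' : v.asIdeal.inertiaDeg (𝓞 ℚ) = 2 := by rw [hvw]; exact hf
    exact (IsAnticyclotomic.resOfLe_mem_awayKer_iff_of_inertiaDeg_eq_two hK hκ hpv
      (ℓ := v₀) rfl hf' c).mp h1
  · -- ramification index two: `v` splits completely as well
    have hvw : v = w := by
      have hmem : v ∈ {w' : HeightOneSpectrum (𝓞 K) | w'.under (𝓞 ℚ) = v₀} := rfl
      rw [hset] at hmem
      exact hmem
    have he' : v.asIdeal.ramificationIdx (𝓞 ℚ) = 2 := by rw [hvw]; exact he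
    exact (IsAnticyclotomic.resOfLe_mem_awayKer_iff_of_ramificationIdx_eq_two hK hκ hpv he' c).mp
      h1

variable {W}
variable {𝔭 : HeightOneSpectrum (𝓞 K)} {W' : WeierstrassCurve ℚ} {C : VariableChange ℚ}

/-- **EXACT CONTROL at a `3`-frame, anticyclotomic `κ`, from (A𝔭)₃ and the degree-one away input.**
At a `3`-frame `(K, 𝔭, W', C)` of `W` (`K = ℚ(√−3)` imaginary quadratic), for every ANTICYCLOTOMIC
`ℤ₃`-extension `κ` with topological generator `γ`: granted `W(K_𝔭)[3] = 0` and (Av)₃, the control map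
`s : Sel_𝔭(K, W[3^∞]) → Sel_𝔭(K_∞, W[3^∞])^γ` (`Σ = ∅`) is bijective (Greenberg Lemmas 3.1–3.3; the
infinite places are complex). [cite: GreenbergLNM1716, §3 Lemmas 3.1–3.3 and p. 90 (Thm. 1.2)]
[cite: Castella2018, Def. 2.2 and Thm. 2.3 (arXiv:1704.06608 p. 5) (shape only)] -/
theorem controlMap_bijective_of_isFrameThree (hF : IsFrameThree W K 𝔭 W' C)
    (κ : ZpExtension K 3) (hκ : κ.IsAnticyclotomic) (γ : absoluteGaloisGroup K)
    [hγ : Fact (κ.IsTopGenerator γ)]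
    (h𝔭 : ∀ R : ((W.baseChange K).baseChange (𝔭.adicCompletion K)).toAffine.Point,
      (3 : ℕ) • R = 0 → R = 0)
    (hv : ∀ v : HeightOneSpectrum (𝓞 K), ((3 : ℕ) : 𝓞 K) ∉ v.asIdeal →
      v.asIdeal.ramificationIdx (𝓞 ℚ) = 1 → v.asIdeal.inertiaDeg (𝓞 ℚ) = 1 →
      (W.baseChange K).HasGoodReductionAt v ∨
        ∀ R : ((W.baseChange K).baseChange (v.adicCompletion K)).toAffine.Point,
          (3 : ℕ) • R = 0 → R = 0) :
    Function.Bijective (controlMap (W.baseChange K) 3 κ 𝔭 ∅ γ) := by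
  haveI : IsTotallyComplex K := hF.2.2.1.2
  haveI : (W.baseChange K).IsElliptic := by rw [baseChange]; infer_instance
  exact controlMap_bijective_of_away_descent (W.baseChange K) 3 κ 𝔭 ∅ hγ.out
    (resSubgroup_kerSubgroup_injective_of_fixedPoints_eq_bot (W.baseChange K) 3 κ hγ.out
      (RamifiedSevenEllipticUnits.fixedPoints_kerSubgroup_eq_bot_of_noPTorsion
        (W.baseChange K) 3 κ 𝔭 h𝔭))
    (RamifiedSevenEllipticUnits.fixedPoints_decomp_inf_kerSubgroup_eq_bot_of_noPTorsion
      (W.baseChange K) 3 κ 𝔭 h𝔭)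
    (fun c hc v hpv _ ↦ awayConditions_descend_three W hF.2.2.1.1 hκ 𝔭 hv c hc v hpv)

/-- **`#H⁰(Γ, Sel_𝔭(K_∞^{ac}, W[3^∞])) = #Sel_𝔭(K, W[3^∞])`** at a `3`-frame from (A𝔭)₃ and (Av)₃
(`Nat.card`). [cite: GreenbergLNM1716, §3 Thm. 1.2 and p. 90] -/
theorem strictControl_frameThree_natCard_eq (hF : IsFrameThree W K 𝔭 W' C)
    (κ : ZpExtension K 3) (hκ : κ.IsAnticyclotomic) (γ : absoluteGaloisGroup K)
    [Fact (κ.IsTopGenerator γ)]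
    (h𝔭 : ∀ R : ((W.baseChange K).baseChange (𝔭.adicCompletion K)).toAffine.Point,
      (3 : ℕ) • R = 0 → R = 0)
    (hv : ∀ v : HeightOneSpectrum (𝓞 K), ((3 : ℕ) : 𝓞 K) ∉ v.asIdeal →
      v.asIdeal.ramificationIdx (𝓞 ℚ) = 1 → v.asIdeal.inertiaDeg (𝓞 ℚ) = 1 →
      (W.baseChange K).HasGoodReductionAt v ∨
        ∀ R : ((W.baseChange K).baseChange (v.adicCompletion K)).toAffine.Point,
          (3 : ℕ) • R = 0 → R = 0) :
    Nat.card (IwasawaDual.endInvariants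
        (Castella2018.AcSelmer.conjSelmerAc (W.baseChange K) 3 κ 𝔭 ∅ γ - 1)) =
      Nat.card (selmerAcBase (W.baseChange K) 3 𝔭 ∅) := by
  haveI : (W.baseChange K).IsElliptic := by rw [baseChange]; infer_instance
  exact (natCard_selmerAcBase_eq_of_bijective (W.baseChange K) 3 κ 𝔭 ∅ γ
    (controlMap_bijective_of_isFrameThree hF κ hκ γ h𝔭 hv)).symm

/-- … and `H⁰(Γ, Sel_𝔭(K_∞^{ac}, W[3^∞]))` is finite iff `Sel_𝔭(K, W[3^∞])` is.
[cite: GreenbergLNM1716, §3 Thm. 1.2] -/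
theorem strictControl_frameThree_finite_iff (hF : IsFrameThree W K 𝔭 W' C)
    (κ : ZpExtension K 3) (hκ : κ.IsAnticyclotomic) (γ : absoluteGaloisGroup K)
    [Fact (κ.IsTopGenerator γ)]
    (h𝔭 : ∀ R : ((W.baseChange K).baseChange (𝔭.adicCompletion K)).toAffine.Point,
      (3 : ℕ) • R = 0 → R = 0)
    (hv : ∀ v : HeightOneSpectrum (𝓞 K), ((3 : ℕ) : 𝓞 K) ∉ v.asIdeal →
      v.asIdeal.ramificationIdx (𝓞 ℚ) = 1 → v.asIdeal.inertiaDeg (𝓞 ℚ) = 1 →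
      (W.baseChange K).HasGoodReductionAt v ∨
        ∀ R : ((W.baseChange K).baseChange (v.adicCompletion K)).toAffine.Point,
          (3 : ℕ) • R = 0 → R = 0) :
    Finite (IwasawaDual.endInvariants
        (Castella2018.AcSelmer.conjSelmerAc (W.baseChange K) 3 κ 𝔭 ∅ γ - 1)) ↔
      Finite (selmerAcBase (W.baseChange K) 3 𝔭 ∅) := by
  haveI : (W.baseChange K).IsElliptic := by rw [baseChange]; infer_instance
  exact (finite_selmerAcBase_iff_of_bijective (W.baseChange K) 3 κ 𝔭 ∅ γ
    (controlMap_bijective_of_isFrameThree hF κ hκ γ h𝔭 hv)).symm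

end Control

/-! ## §3 The twist-descent count at a `3`-frame (unconditional) -/

/-- **(D♮)₃ `#Sel_𝔭(K, E[3^∞]) = #Sel_str(E/ℚ)[3^∞] · #Sel_str(E'/ℚ)[3^∞]`** at a `3`-frame, in
`Nat.card` (no finiteness hypothesis): Castella bridge (`𝔭` is the unique prime above the ramified
`3`, `K` totally complex), the strict `±`-decomposition at the ODD prime `3` for `K = ℚ(θ)`, `θ² = −3`,
and `E^{(d_K)} ≅ E'` over `ℚ` — k7r-c3's `natCard_selmerAcBase_frame_eq_mul_prime`, whose three inputs
are `p`-generic for odd `p`. [cite: DokchitserDokchitserAnnals2010, Lemma 4.14 (proof)]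
[cite: Castella2018, Def. 2.2 (arXiv:1704.06608 p. 5)] -/
theorem natCard_selmerAcBase_frameThree_eq_mul (W : WeierstrassCurve ℚ) [W.IsElliptic]
    {K : Type} [Field K] [NumberField K] {𝔭 : HeightOneSpectrum (𝓞 K)}
    {W' : WeierstrassCurve ℚ} {C : VariableChange ℚ} (hF : IsFrameThree W K 𝔭 W' C) :
    Nat.card (selmerAcBase (W.baseChange K) 3 𝔭 ∅) =
      Nat.card ↥(strictSelmerPInfty W 3) * Nat.card ↥(strictSelmerPInfty W' 3) := by
  have hK : IsImaginaryQuadratic K := hF.2.2.1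
  have hdisc : NumberField.discr K = cmFieldDiscrOfJ W.j := hF.2.2.2.1
  have h𝔭 : ((3 : ℕ) : 𝓞 K) ∈ 𝔭.asIdeal := hF.2.2.2.2.1
  have hW' : C • W.quadraticTwist ((cmFieldDiscrOfJ W.j : ℤ) : ℚ) = W' := hF.2.2.2.2.2
  haveI : IsTotallyComplex K := hK.2
  haveI : (W.baseChange K).IsElliptic := by rw [baseChange]; infer_instance
  have huniq : ∀ v : HeightOneSpectrum (𝓞 K), ((3 : ℕ) : 𝓞 K) ∈ v.asIdeal → v = 𝔭 :=
    fun v hv ↦ hF.eq_of_mem hv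
  obtain ⟨θ, hθ, hθsq⟩ := exists_sq_eq_discr_not_mem_range K hK.1
  rw [hdisc] at hθsq
  rw [RamifiedSevenEllipticUnits.natCard_selmerAcBase_eq_natCard_iInf (W.baseChange K) 3 𝔭 huniq,
    RamifiedSevenEllipticUnits.natCard_iInf_selmerLocalKerPrimaryTorsion_eq_mul W K hK.1 hθ hθsq 3
      (by decide) h𝔭,
    RamifiedSevenEllipticUnits.natCard_strictSelmerPInfty_eq_of_variableChange 3 hW']

end Summit.BirchSwinnertonDyer.Rank1Residual.X12.O11

end
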